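import Mathlib
import HarnessLib
import Summits.Ventures.LatticeQCDFlow.Scoring.AcceptanceMonitorConcentration
import Summits.Ventures.LatticeQCDFlow.Scoring.AllPairsAcceptanceVariance

/-!
# LatticeQCDFlow / Scoring — concentration of the PRINTED acceptance monitor `acc_est` on `n`
# fresh proposals of ANY flow on ANY measurable space: off by `(t + s)/(1 − s)` or more only with
# model probability `≤ (n + 1)/(n(n − 1)t²) + (1/ESS − 1)/(n s²)`

HONEST FRAMING: exact (Metropolis-corrected) sampling algorithms for lattice gauge theory;
figures of merit are autocorrelation/cost numbers at stated couplings and volumes; no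
continuum-physics claim.

Venture `LatticeQCDFlow` (cell pub-lqcd), sub-topic `Scoring`; FANOUT row 3 (`s0-u1-a`, S0-B
implementation A, GEN-10).  NEW WORK of the cell (Chebyshev twice and a union bound), the
general-space form of row 3's `Scoring/AcceptanceMonitorConcentration` (GEN-7, finite
configuration spaces; imported for its two deterministic steps `accMonitor_eq_ratio` —
`acc_est = U / W̄` — and `abs_div_sub_lt_of_abs_sub_lt`), with the numerator's share improved from
`4/(n t²)` to the sharp `(n + 1)/(n(n − 1)t²)` of row 3's `Scoring/AllPairsAcceptanceVariance`
(imported).  Setting of row 4's `Scoring/AllPairsAcceptance`: reference measure `μ` on a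
measurable space `X`, target density `p ≥ 0` (`∫ p dμ = 1`), model density `q > 0`, `n ≥ 2`
mutually independent model draws `x_i : Ω → X` with law `q dμ`, importance ratios `w = p/q` with
a finite second moment under the model (`w ∈ L²(q dμ)`, i.e. a positive population ESS);
`V = ∫ (w − 1)² q dμ = Var_q w = 1/ESS − 1`.  NO weight ceiling; NO definition is introduced.

* `memLp_weight_comp`, `integral_weight_comp_eq_one`, `variance_weight_comp_eq` — each `w(x_i)`
  is in `L²(P)` with mean `1` and variance `V`; `memLp_weight_two_iff` (`w ∈ L²(q dμ)` iff row
  2's weight moment `W = ∫ (p/q)p dμ` is finite) and `integral_weightVar_eq` (`V = W − 1`);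
* **`variance_meanWeight_iid`** — `Var[W̄] = V/n` for the batch mean weight `W̄ = (Σ_i w(x_i))/n`
  (pairwise independence, Mathlib's `IndepFun.variance_sum`); `integral_meanWeight_eq_one`;
  **`chebyshev_meanWeight_iid`** — `P(|W̄ − 1| ≥ s) ≤ V/(n s²)`;
* **`accMonitor_concentration_iid`** — for all `t > 0`, `0 < s < 1`: the model probability of
  `|acc_est − acc(p, q)| ≥ (t + s)/(1 − s)`, where
  `acc_est = Σ_{i≠j} min(w(x_i), w(x_j)) / ((n − 1)·Σ_i w(x_i))` is the printed (scale-free)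
  monitor, is at most `(n + 1)/(n(n − 1)t²) + V/(n s²)`.

Reading (value-free; nothing re-scored): on continuous field space exactly as on finite spaces,
the printed acceptance estimate of a checkpoint with `n` fresh proposals is a certified reading of
the equilibrium acceptance to within `(t + s)/(1 − s)` at Chebyshev confidence
`1 − (n + 1)/(n(n − 1)t²) − (1/ESS − 1)/(n s²)`; the only flow-dependent input is the population
ESS.  NOT CLAIMED: any ESS, acceptance or monitor value of ours; exponential concentration
(weights unbounded); a variance formula for the ratio itself.
-/

namespace Summit.Ventures.LatticeQCDFlow.Scoring.AllPairsVariance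

open MeasureTheory ProbabilityTheory Finset

variable {Ω : Type*} [MeasurableSpace Ω] {P : Measure Ω} [IsProbabilityMeasure P]
variable {X : Type*} [MeasurableSpace X] {μ : Measure X} {n : ℕ}

/-! ## §1 One model draw: the weight has mean `1` and variance `V` -/

omit [IsProbabilityMeasure P] in
/-- `w(x_i) ∈ L²(P)` when `w ∈ L²(q dμ)` and `x_i` has law `q dμ`. [folklore] -/
theorem memLp_weight_comp {x : Fin n → Ω → X} (hxm : ∀ i, Measurable (x i)) {p q : X → ℝ}
    (hw2 : MemLp (fun y => p y / q y) 2 (μ.withDensity fun y => ENNReal.ofReal (q y)))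
    (hlaw : ∀ i, Measure.map (x i) P = μ.withDensity fun y => ENNReal.ofReal (q y)) (i : Fin n) :
    MemLp (fun ω => p (x i ω) / q (x i ω)) 2 P := by
  rw [← hlaw i] at hw2
  exact hw2.comp_of_map (hxm i).aemeasurable

omit [IsProbabilityMeasure P] in
/-- **`E w(x_i) = ∫ p dμ = 1`.** [ours] -/
theorem integral_weight_comp_eq_one {x : Fin n → Ω → X} (hxm : ∀ i, Measurable (x i))
    {p q : X → ℝ} (hpm : Measurable p) (hpi : Integrable p μ) (hp1 : ∫ y, p y ∂μ = 1)
    (hq0 : ∀ y, 0 < q y) (hqm : Measurable q)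
    (hlaw : ∀ i, Measure.map (x i) P = μ.withDensity fun y => ENNReal.ofReal (q y)) (i : Fin n) :
    ∫ ω, p (x i ω) / q (x i ω) ∂P = 1 := by
  have hwm : Measurable fun y => p y / q y := hpm.div hqm
  rw [← integral_map (hxm i).aemeasurable hwm.aestronglyMeasurable, hlaw i,
    (integral_weight_withDensity_eq (μ := μ) hpi hq0 hqm).2, hp1]

omit [IsProbabilityMeasure P] in
/-- **`Var w(x_i) = V = ∫ (w − 1)² q dμ`** (`= 1/ESS − 1`). [ours] -/
theorem variance_weight_comp_eq [IsProbabilityMeasure P] {x : Fin n → Ω → X}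
    (hxm : ∀ i, Measurable (x i)) {p q : X → ℝ} (hpm : Measurable p) (hpi : Integrable p μ)
    (hp1 : ∫ y, p y ∂μ = 1) (hq0 : ∀ y, 0 < q y) (hqm : Measurable q)
    (hlaw : ∀ i, Measure.map (x i) P = μ.withDensity fun y => ENNReal.ofReal (q y)) (i : Fin n) :
    Var[fun ω => p (x i ω) / q (x i ω); P] = ∫ y, (p y / q y - 1) ^ 2 * q y ∂μ := by
  have hwm : Measurable fun y => p y / q y := hpm.div hqm
  have hX : AEMeasurable (fun ω => p (x i ω) / q (x i ω)) P := (hwm.comp (hxm i)).aemeasurable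
  rw [variance_eq_integral hX]
  change ∫ ω, (p (x i ω) / q (x i ω) - ∫ ω, p (x i ω) / q (x i ω) ∂P) ^ 2 ∂P = _
  rw [integral_weight_comp_eq_one hxm hpm hpi hp1 hq0 hqm hlaw i,
    ← integral_map (hxm i).aemeasurable (f := fun y => (p y / q y - 1) ^ 2)
      ((hwm.sub_const 1).pow_const 2).aestronglyMeasurable, hlaw i,
    integral_withDensity_eq' (fun y => (hq0 y).le) hqm]

omit [IsProbabilityMeasure P] in
/-- **`w ∈ L²(q dμ)` iff row 2's weight moment `W = ∫ (p/q)·p dμ` is finite** (the hypothesis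
`hw2` below, in the vocabulary of `Exactness/IMHAcceptanceGeESS`). [folklore] -/
theorem memLp_weight_two_iff {p q : X → ℝ} (hpm : Measurable p) (hq0 : ∀ y, 0 < q y)
    (hqm : Measurable q) :
    MemLp (fun y => p y / q y) 2 (μ.withDensity fun y => ENNReal.ofReal (q y))
      ↔ Integrable (fun y => p y / q y * p y) μ := by
  have e : ∀ y, (p y / q y) ^ 2 * q y = p y / q y * p y := fun y => by
    rw [sq, mul_assoc, div_mul_cancel₀ _ (hq0 y).ne']
  have hwm : Measurable fun y => p y / q y := hpm.div hqm
  rw [memLp_two_iff_integrable_sq hwm.aestronglyMeasurable,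
    integrable_withDensity_iff' (fun y => (hq0 y).le) hqm]
  simp_rw [e]

omit [IsProbabilityMeasure P] in
/-- **`V = W − 1 = 1/κ − 1`**: `∫ (w − 1)² q dμ = ∫ (p/q)·p dμ − 1` for normalised `p` and `q`
(`κ = 1/W` the population ESS fraction). [folklore] -/
theorem integral_weightVar_eq {p q : X → ℝ} (hpi : Integrable p μ) (hp1 : ∫ y, p y ∂μ = 1)
    (hq0 : ∀ y, 0 < q y) (hqi : Integrable q μ) (hq1 : ∫ y, q y ∂μ = 1)
    (hW : Integrable (fun y => p y / q y * p y) μ) :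
    ∫ y, (p y / q y - 1) ^ 2 * q y ∂μ = (∫ y, p y / q y * p y ∂μ) - 1 := by
  have e : ∀ y, (p y / q y - 1) ^ 2 * q y = p y / q y * p y - 2 * p y + q y := fun y => by
    have hq := (hq0 y).ne'
    field_simp
    ring
  simp_rw [e]
  have h1 : Integrable (fun y => p y / q y * p y - 2 * p y) μ := hW.sub (hpi.const_mul 2)
  rw [integral_add h1 hqi, integral_sub hW (hpi.const_mul 2), integral_const_mul, hp1, hq1]
  ring

/-! ## §2 The batch mean weight: variance `V/n`, Chebyshev -/

/-- **`Var[W̄] = V/n`** for the mean `W̄ = (Σ_i w(x_i))/n` of `n ≥ 1` independent model draws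
(pairwise independence suffices; Mathlib's `IndepFun.variance_sum`). [ours] -/
theorem variance_meanWeight_iid {x : Fin n → Ω → X} (hxm : ∀ i, Measurable (x i))
    (hind : iIndepFun x P) {p q : X → ℝ} (hpm : Measurable p) (hpi : Integrable p μ)
    (hp1 : ∫ y, p y ∂μ = 1) (hq0 : ∀ y, 0 < q y) (hqm : Measurable q)
    (hw2 : MemLp (fun y => p y / q y) 2 (μ.withDensity fun y => ENNReal.ofReal (q y)))
    (hlaw : ∀ i, Measure.map (x i) P = μ.withDensity fun y => ENNReal.ofReal (q y)) (hn : 1 ≤ n) :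
    Var[fun ω => (∑ i, p (x i ω) / q (x i ω)) / (n : ℝ); P]
      = (∫ y, (p y / q y - 1) ^ 2 * q y ∂μ) / n := by
  have hwm : Measurable fun y => p y / q y := hpm.div hqm
  have hsum : Var[∑ i, fun ω => p (x i ω) / q (x i ω); P]
      = n * ∫ y, (p y / q y - 1) ^ 2 * q y ∂μ := by
    rw [IndepFun.variance_sum (fun i _ => memLp_weight_comp hxm hw2 hlaw i)
        (fun i _ j _ hij => (hind.indepFun hij).comp hwm hwm),
      sum_congr rfl fun i _ => variance_weight_comp_eq hxm hpm hpi hp1 hq0 hqm hlaw i, sum_const,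
      card_univ, Fintype.card_fin, nsmul_eq_mul]
  have hfun : (fun ω => (∑ i, p (x i ω) / q (x i ω)) / (n : ℝ))
      = fun ω => (n : ℝ)⁻¹ * (∑ i, fun ω => p (x i ω) / q (x i ω)) ω := by
    funext ω
    rw [Finset.sum_apply, div_eq_inv_mul]
  have hn0 : (n : ℝ) ≠ 0 := by
    have : (1 : ℝ) ≤ n := by exact_mod_cast hn
    positivity
  rw [hfun, variance_const_mul, hsum]
  field_simp

/-- **`E W̄ = 1`.** [ours] -/
theorem integral_meanWeight_eq_one {x : Fin n → Ω → X} (hxm : ∀ i, Measurable (x i))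
    {p q : X → ℝ} (hpm : Measurable p) (hpi : Integrable p μ) (hp1 : ∫ y, p y ∂μ = 1)
    (hq0 : ∀ y, 0 < q y) (hqm : Measurable q)
    (hw2 : MemLp (fun y => p y / q y) 2 (μ.withDensity fun y => ENNReal.ofReal (q y)))
    (hlaw : ∀ i, Measure.map (x i) P = μ.withDensity fun y => ENNReal.ofReal (q y)) (hn : 1 ≤ n) :
    ∫ ω, (∑ i, p (x i ω) / q (x i ω)) / (n : ℝ) ∂P = 1 := by
  have hn0 : (n : ℝ) ≠ 0 := by
    have : (1 : ℝ) ≤ n := by exact_mod_cast hn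
    positivity
  rw [integral_div, integral_finsetSum _ fun i _ =>
      (memLp_weight_comp hxm hw2 hlaw i).integrable one_le_two,
    sum_congr rfl fun i _ => integral_weight_comp_eq_one hxm hpm hpi hp1 hq0 hqm hlaw i,
    sum_const, card_univ, Fintype.card_fin, nsmul_eq_mul, mul_one, div_self hn0]

/-- **Chebyshev for the batch mean weight**: `P(|W̄ − 1| ≥ s) ≤ V/(n s²)`. [ours] -/
theorem chebyshev_meanWeight_iid {x : Fin n → Ω → X} (hxm : ∀ i, Measurable (x i))
    (hind : iIndepFun x P) {p q : X → ℝ} (hpm : Measurable p) (hpi : Integrable p μ)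
    (hp1 : ∫ y, p y ∂μ = 1) (hq0 : ∀ y, 0 < q y) (hqm : Measurable q)
    (hw2 : MemLp (fun y => p y / q y) 2 (μ.withDensity fun y => ENNReal.ofReal (q y)))
    (hlaw : ∀ i, Measure.map (x i) P = μ.withDensity fun y => ENNReal.ofReal (q y)) (hn : 1 ≤ n)
    {s : ℝ} (hs : 0 < s) :
    P.real {ω | s ≤ |(∑ i, p (x i ω) / q (x i ω)) / (n : ℝ) - 1|}
      ≤ (∫ y, (p y / q y - 1) ^ 2 * q y ∂μ) / (n * s ^ 2) := by
  have hWb : MemLp (fun ω => (∑ i, p (x i ω) / q (x i ω)) / (n : ℝ)) 2 P :=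
    ((memLp_finsetSum (univ : Finset (Fin n)) fun i _ =>
        memLp_weight_comp hxm hw2 hlaw i).mul_const ((n : ℝ))⁻¹).ae_eq
      (Filter.Eventually.of_forall fun ω => by simp only [div_eq_mul_inv])
  have h := meas_ge_le_variance_div_sq hWb hs
  have hm : ∫ ω, (fun ω => (∑ i, p (x i ω) / q (x i ω)) / (n : ℝ)) ω ∂P = 1 :=
    integral_meanWeight_eq_one hxm hpm hpi hp1 hq0 hqm hw2 hlaw hn
  rw [hm, variance_meanWeight_iid hxm hind hpm hpi hp1 hq0 hqm hw2 hlaw hn] at h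
  have hV0 : 0 ≤ ∫ y, (p y / q y - 1) ^ 2 * q y ∂μ :=
    integral_nonneg fun y => mul_nonneg (sq_nonneg _) (hq0 y).le
  have hnpos : (0 : ℝ) < n := by
    have : (1 : ℝ) ≤ n := by exact_mod_cast hn
    linarith
  refine ENNReal.toReal_le_of_le_ofReal (by positivity) (h.trans (le_of_eq ?_))
  rw [div_div]

/-! ## §3 The ratio: union bound -/

/-- **Concentration of the printed acceptance monitor on a general space.**  For a normalised
target `p ≥ 0`, a model density `q > 0` with `w = p/q ∈ L²(q dμ)`, `n ≥ 2` independent model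
draws, any `t > 0` and `0 < s < 1`: the model probability that the self-normalised monitor
`acc_est = Σ_{i≠j} min(w(x_i), w(x_j))/((n − 1)Σ_i w(x_i))` (equal to the printed one on `c·w` by
row 3's `accMonitor_scale_free`) misses `acc(p, q)` by `(t + s)/(1 − s)` or more is at most
`(n + 1)/(n(n − 1)t²) + V/(n s²)`, `V = ∫ (w − 1)² q dμ = 1/ESS − 1` — union of the two Chebyshev
events for the all-pairs statistic `Û` (`chebyshev_allPairs_sharp_real`) and the mean weight
`W̄`; outside both, `abs_div_sub_lt_of_abs_sub_lt`. [ours] -/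
theorem accMonitor_concentration_iid [SFinite μ] {x : Fin n → Ω → X}
    (hxm : ∀ i, Measurable (x i))
    (hind : iIndepFun x P) {p q : X → ℝ} (hp0 : ∀ y, 0 ≤ p y) (hpm : Measurable p)
    (hpi : Integrable p μ) (hp1 : ∫ y, p y ∂μ = 1) (hq0 : ∀ y, 0 < q y) (hqm : Measurable q)
    (hqi : Integrable q μ)
    (hw2 : MemLp (fun y => p y / q y) 2 (μ.withDensity fun y => ENNReal.ofReal (q y)))
    (hlaw : ∀ i, Measure.map (x i) P = μ.withDensity fun y => ENNReal.ofReal (q y))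
    (hn : 2 ≤ n) {t s : ℝ} (ht : 0 < t) (hs : 0 < s) (hs1 : s < 1) :
    P.real {ω | (t + s) / (1 - s) ≤
        |(∑ i, ∑ j ∈ univ.erase i, min (p (x i ω) / q (x i ω)) (p (x j ω) / q (x j ω)))
            / ((n - 1) * ∑ i, p (x i ω) / q (x i ω))
          - ∫ a, ∫ b, min (p a * q b) (p b * q a) ∂μ ∂μ|}
      ≤ (n + 1) / (n * (n - 1)) / t ^ 2 + (∫ y, (p y / q y - 1) ^ 2 * q y ∂μ) / (n * s ^ 2) := by
  classical
  haveI := isProbabilityMeasure_of_map_eq_iid (hxm ⟨0, by omega⟩) (hlaw ⟨0, by omega⟩)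
  have hn1 : 1 ≤ n := le_trans (by norm_num) hn
  obtain ⟨ha0, ha1⟩ := meanAccept_mem_Icc (μ := μ) hp0 hpm hpi hp1 hq0 hqm hqi
  have hA := chebyshev_allPairs_sharp_real hxm hind hp0 hpm hpi hp1 hq0 hqm hqi hlaw hn ht
  have hB := chebyshev_meanWeight_iid hxm hind hpm hpi hp1 hq0 hqm hw2 hlaw hn1 hs
  set acc : ℝ := ∫ a, ∫ b, min (p a * q b) (p b * q a) ∂μ ∂μ with hacc
  set U : Ω → ℝ := fun ω => (∑ z ∈ (univ : Finset (Fin n)).offDiag,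
    min (p (x z.1 ω) / q (x z.1 ω)) (p (x z.2 ω) / q (x z.2 ω))) / (n * (n - 1)) with hU
  set Wb : Ω → ℝ := fun ω => (∑ i, p (x i ω) / q (x i ω)) / (n : ℝ) with hWb
  have hsub : {ω | (t + s) / (1 - s) ≤
        |(∑ i, ∑ j ∈ univ.erase i, min (p (x i ω) / q (x i ω)) (p (x j ω) / q (x j ω)))
            / ((n - 1) * ∑ i, p (x i ω) / q (x i ω)) - acc|}
      ⊆ {ω | t ≤ |U ω - acc|} ∪ {ω | s ≤ |Wb ω - 1|} := by
    intro ω hω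
    simp only [Set.mem_setOf_eq, Set.mem_union] at hω ⊢
    rw [accMonitor_eq_ratio (fun i => p (x i ω) / q (x i ω)) hn1] at hω
    by_contra hnot
    obtain ⟨h1, h2⟩ := not_or.mp hnot
    have hlt := abs_div_sub_lt_of_abs_sub_lt ha0 ha1 hs1 (not_le.mp h1) (not_le.mp h2)
    exact absurd hω (not_le.mpr hlt)
  calc P.real {ω | (t + s) / (1 - s) ≤
        |(∑ i, ∑ j ∈ univ.erase i, min (p (x i ω) / q (x i ω)) (p (x j ω) / q (x j ω)))
            / ((n - 1) * ∑ i, p (x i ω) / q (x i ω)) - acc|}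
      ≤ P.real ({ω | t ≤ |U ω - acc|} ∪ {ω | s ≤ |Wb ω - 1|}) := measureReal_mono hsub
    _ ≤ P.real {ω | t ≤ |U ω - acc|} + P.real {ω | s ≤ |Wb ω - 1|} :=
        measureReal_union_le _ _
    _ ≤ _ := add_le_add hA hB

end Summit.Ventures.LatticeQCDFlow.Scoring.AllPairsVariance
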